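import Summits.BirchSwinnertonDyer.Rank1Residual.X11b.LocalTrivialityBridge
import Summits.BirchSwinnertonDyer.Rank1Residual.Iwasawa.LocalTowerKernelAdditive
import Literature.NumberTheory.GaloisRepresentations.InertiaCohomologyTorsionBound
import Literature.NumberTheory.GaloisRepresentations.ContinuousH1TrivialAction
import Literature.NumberTheory.EllipticCurves.GreenbergVatsal2000.GreenbergSelmerGroups
import Literature.NumberTheory.EllipticCurves.LocalH1TateDualityLangTateProofs
import Literature.NumberTheory.EllipticCurves.PointDivisibilityProofs
import HarnessLib

/-!
# `H¹(I_v, E[p^∞])` is FINITE at an additive place `v ∤ p` (Greenberg–Vatsal §2 Prop. (2.4) at an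
# additive `ℓ ∈ Σ₀`: `d_ℓ = 0`) — cell `b2b-bsdres`, unit `b2b-bsdres-eisenstein-p2`, gen 29

HONEST FRAMING (run/shared/lean/b2b/bsd-rank1-residual/, verbatim in every file): the goal of the
cell is to DELETE the COMBINATION-SHAPED residual classes of the Birch–Swinnerton-Dyer formula for
ALL analytic-rank `≤ 1` elliptic curves over `ℚ` — "full BSD formula for every rank `≤ 1` curve in
class `C`" assembled STRICTLY from published theorems — so that the rank-`≤ 1` remainder becomes
exactly the CONSTRUCTION-SHAPED classes, which are TYPED (missing-input `Prop`s), NOT attempted.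
This is not "finishing BSD". Research route; NO CLAIM BEYOND STATED CLASSES; nothing here changes
a label. Theorems only; no definition, no named fact.

WHAT (programme P1 of X2-GAP §34 = the upper half of Greenberg–Vatsal's Cor. (2.3)/Prop. (2.4) in
the kernel; local step at an ADDITIVE place). For `E/K` elliptic over a number field, a prime `p`, a
finite place `v ∤ p` of ADDITIVE reduction and a subgroup `H ≤ Γ_K` containing the inertia group
`I_v` (e.g. `H = Gal(K̄/K_∞)` for a `ℤ_p`-extension, unramified at `v`), the group
`H¹(H ∩ I_v, E[p^∞]) = H¹(I_v, E[p^∞])` of the tree's place-by-place formalism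
(`discreteH1 (inertiaIn H v) (W.geomPrimaryTorsion p)`, the target of the local condition
`GreenbergVatsal2000.unramifiedKer`) is FINITE:

* `finite_discreteH1_inertiaIn_of_hasAdditiveReductionAt`.

So the `v`-component of `S^{Σ₀}_A(K_∞)/S_A(K_∞)` has `ℤ_p`-corank `0 = d_v` (GV p. 22: `P_v = 1`
at an additive place). Ingredients: the surjection `absInertia K_v ↠ H ∩ I_v` and the injectivity
of inflation in degree one (`ContinuousH1TrivialAction.map_one_injective_of_surjective`); the bound
`#H¹(I_{K_v}, A)[p^k] ≤ #(A[p^k])^{I_{K_v}}` (`InertiaCohomologyTorsionBound`, Serre *Local Fields*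
IV §2 / XIII §1); and the cell's `Iwasawa/LocalTowerKernelAdditive` (team n1011): at an additive
`v ∤ p` an inertia-fixed `p`-power torsion point is killed by a Kodaira–Néron exponent `c ≤ 4`
(Silverman *AEC* VII.6.1, *ATAEC* IV.10.2(a)), so `#(A[p^k])^{I} ≤ #E[c]` uniformly in `k`.

References: [GreenbergVatsal2000] §2 Prop. (2.4) p. 22; [Greenberg1989] Prop. 2; [SerreLocalFields1979]
IV §2, XIII §1; [SilvermanAEC2009] VII.6.1; HOME/b2b-bsdres-eisenstein-p2/X2-GAP.md §34.
-/

set_option autoImplicit false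

noncomputable section

open scoped Classical NNReal

open CategoryTheory Function NumberField IsDedekindDomain Field ValuativeRel
open Literature.NumberTheory.EllipticCurves Literature.NumberTheory.EllipticCurves.GreenbergSelmer
  Literature.NumberTheory.GaloisRepresentations
  Literature.NumberTheory.GaloisRepresentations.IsNonarchimedeanLocalField
  Summit.BirchSwinnertonDyer.Rank1Residual.X11b.LocBridge
  Summit.BirchSwinnertonDyer.Rank1Residual.Iwasawa

universe u

namespace Summit.BirchSwinnertonDyer.Rank1Residual.X2.LocalInertiaCohomologyAdditive

variable {K : Type u} [Field K] [NumberField K] (W : WeierstrassCurve K) (p : ℕ) [hp : Fact p.Prime]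
  (H : Subgroup (absoluteGaloisGroup K)) (v : HeightOneSpectrum (𝓞 K))

/-! ## §1. Generic: a `p`-primary group with uniformly bounded `p^k`-torsion is finite -/

omit hp in
/-- A `p`-primary abelian group all of whose finite subsets have at most `C` elements — e.g.
because every element is `p^k`-torsion for some `k` and `#G[p^k] ≤ C` for all `k` — is finite of
order `≤ C`. [folklore] -/
theorem finite_of_forall_finset_card_le {G : Type*} [AddCommGroup G] (C : ℕ)
    (h : ∀ s : Finset G, s.card ≤ C) : Finite G := by
  by_contra hinf
  rw [not_finite_iff_infinite] at hinf
  obtain ⟨s, hs⟩ := Infinite.exists_subset_card_eq G (C + 1)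
  have := h s
  omega

/-! ## §2. The local statement -/

/-- **`H¹(H ∩ I_v, E[p^∞])` is finite at an ADDITIVE place `v ∤ p`** (for `I_v ≤ H`). Proof:
`H ∩ I_v = I_v` is the image of the local inertia group `absInertia K_v`, so `H¹(H ∩ I_v, E[p^∞])`
injects into `H¹(absInertia K_v, E[p^∞])` (inflation along a surjection,
`map_one_injective_of_surjective`); every class there is killed by a power of `p` (a continuous
cocycle on a compact group with values in the discrete `p`-primary `E[p^∞]` has finite image), and
`#H¹(absInertia K_v, E[p^∞])[p^k] ≤ #(E[p^k])^{I}` (`natCard_torsionBy_continuousCohomology_one_absInertia_le`,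
`E[p^∞]` being `p^k`-divisible); at an additive `v ∤ p` the inertia-fixed `p`-power torsion is killed
by a Kodaira–Néron exponent `c ∈ {1,…,4}` (`nsmul_localPoints_eq_zero_of_absInertia_fixed_of_exponent`),
hence lies in the finite group `E[p^∞][c]`, uniformly in `k`. This is the case `d_v = 0` (`P_v = 1`)
of Greenberg–Vatsal's Prop. (2.4) on the inertia side.
[cite: GreenbergVatsal2000, §2 Prop. (2.4) (p. 22)] [cite: SerreLocalFields1979, Ch. IV §2 and Ch. XIII §1]
[cite: SilvermanAEC2009, Thm. VII.6.1] -/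
theorem finite_discreteH1_inertiaIn_of_hasAdditiveReductionAt [W.IsElliptic]
    (hpv : ((p : ℕ) : 𝓞 K) ∉ v.asIdeal) (hadd : W.HasAdditiveReductionAt v) (hIH : inertia v ≤ H) :
    Finite (discreteH1 (inertiaIn H v) (W.geomPrimaryTorsion p)) := by
  -- the local field, the module, the local representation
  haveI : CompactSpace (absoluteGaloisGroup (v.adicCompletion K)) :=
    absoluteGaloisGroup_compactSpace (v.adicCompletion K)
  have hIcl : IsClosed (absInertia (v.adicCompletion K) : Set (absoluteGaloisGroup (v.adicCompletion K))) :=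
    isClosed_absInertia_holds (v.adicCompletion K)
  haveI : CompactSpace (absInertia (v.adicCompletion K)) := isCompact_iff_compactSpace.mp hIcl.isCompact
  let ρ : ContinuousRep (absoluteGaloisGroup (v.adicCompletion K)) ℤ (W.geomPrimaryTorsion p) :=
    (primaryGaloisModule W p).restrict (absGaloisRestrict K (v.adicCompletion K))
  -- the surjection `θ : absInertia K_v ↠ H ∩ I_v`
  let θ : absInertia (v.adicCompletion K) →ₜ* inertiaIn H v :=
    { toFun := fun σ ↦ ⟨⟨absGaloisRestrict K (v.adicCompletion K) σ, ⟨σ, rfl⟩⟩,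
        (mem_inertiaIn_iff H v _).2
          ⟨hIH (Subgroup.mem_map_of_mem _ σ.2), Subgroup.mem_map_of_mem _ σ.2⟩⟩
      map_one' := Subtype.ext (Subtype.ext (by simp))
      map_mul' := fun x y ↦ Subtype.ext (Subtype.ext (by simp))
      continuous_toFun := by
        refine Continuous.subtype_mk (Continuous.subtype_mk ?_ _) _
        exact (absGaloisRestrict K (v.adicCompletion K)).continuous_toFun.comp continuous_subtype_val }
  have hθ : Surjective θ := by
    intro x
    obtain ⟨σ, hσ, hσx⟩ := Subgroup.mem_map.1 ((mem_inertiaIn_iff H v x.1).1 x.2).2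
    exact ⟨⟨σ, hσ⟩, Subtype.ext (Subtype.ext hσx)⟩
  -- inflation along `θ` is injective, and its target is `H¹(absInertia K_v, ρ|)`
  have hinj := map_one_injective_of_surjective (discreteTopRep (inertiaIn H v) (W.geomPrimaryTorsion p)) θ hθ
  have heq : TopRep.res (θ : absInertia (v.adicCompletion K) →* inertiaIn H v)
      (discreteTopRep (inertiaIn H v) (W.geomPrimaryTorsion p)) =
      (ρ.restrict (Literature.NumberTheory.GaloisRepresentations.subgroupIncl (absInertia (v.adicCompletion K)))).toTopRep := rfl
  suffices hfin : Finite (continuousCohomology 1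
      ((ρ.restrict (Literature.NumberTheory.GaloisRepresentations.subgroupIncl (absInertia (v.adicCompletion K)))).toTopRep)) from
    @Finite.of_injective _ _ (heq ▸ hfin) _ hinj
  -- every class of `H¹(absInertia K_v, E[p^∞])` is `p^k`-torsion for some `k`
  have hprimary : ∀ x : continuousCohomology 1
      ((ρ.restrict (Literature.NumberTheory.GaloisRepresentations.subgroupIncl (absInertia (v.adicCompletion K)))).toTopRep),
      ∃ k : ℕ, x ∈ Submodule.torsionBy ℤ _ ((p ^ k : ℕ) : ℤ) := by
    intro x
    obtain ⟨φ, rfl⟩ := oneCocycleClass_surjective _ x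
    -- the image of `φ` is finite; each value is killed by a power of `p`
    have hfinim : (Set.range (φ.1 : absInertia (v.adicCompletion K) → W.geomPrimaryTorsion p)).Finite :=
      (isCompact_range φ.1.continuous).finite_of_discrete
    have hval : ∀ m : W.geomPrimaryTorsion p, ∃ k : ℕ, p ^ k • m = 0 := fun m ↦ by
      obtain ⟨k, hk⟩ := (AddCommGroup.mem_primaryComponent).1 m.2
      refine ⟨k, Subtype.ext ?_⟩
      rw [AddSubmonoidClass.coe_nsmul, ZeroMemClass.coe_zero]
      exact hk
    choose k hk using hval
    obtain ⟨N, hN⟩ := (hfinim.image k).bddAbove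
    refine ⟨N, ?_⟩
    rw [Submodule.mem_torsionBy_iff, ← oneCocycleClass_smul, oneCocycleClass_eq_zero_iff]
    refine ⟨0, fun g ↦ ?_⟩
    rw [map_zero, sub_zero]
    show ((p ^ N : ℕ) : ℤ) • φ.1 g = 0
    have hle : k (φ.1 g) ≤ N := hN (Set.mem_image_of_mem k ⟨g, rfl⟩)
    have h1 : ((p ^ k (φ.1 g) : ℕ) : ℤ) • φ.1 g = 0 := by rw [Nat.cast_smul_eq_nsmul]; exact hk _
    rw [← Nat.sub_add_cancel hle, pow_add, Nat.cast_mul, mul_smul, h1, smul_zero]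
  -- the uniform bound `#H¹[p^k] ≤ #(E[p^k])^{I} ≤ #E[p^∞][c]`
  obtain ⟨w, hw⟩ := v.exists_spectralValuation
  obtain ⟨𝔐, h𝔐⟩ := v.localPrimesAbove_nonempty
  haveI : (W.localMinimalModel v).IsElliptic := W.isElliptic_localMinimalModel v
  haveI : (W.localMinimalModel v).HasAdditiveReduction (v.adicCompletionIntegers K) := hadd
  obtain ⟨c, hc0, -, hcE₀⟩ :=
    (W.localMinimalModel v).exists_nsmul_reducesToNonsingular_le_four_of_hasAdditiveReduction w hw h𝔐
  -- the finite group `E[p^∞][c]`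
  let Ac : Submodule ℤ (W.geomPrimaryTorsion p) := Submodule.torsionBy ℤ (W.geomPrimaryTorsion p) (c : ℤ)
  haveI hAcfin : Finite Ac := by
    have hinj' : Injective (fun a : Ac ↦ (⟨((a : W.geomPrimaryTorsion p) : W.geomPoints),
        (W.mem_geomTorsion_iff (c : ℤ) _).2 (by
          have := (Submodule.mem_torsionBy_iff _ _).1 a.2
          rw [← AddSubgroupClass.coe_zsmul, this, ZeroMemClass.coe_zero])⟩ : W.geomTorsion (c : ℤ))) := by
      intro a b hab
      exact Subtype.ext (Subtype.ext (congrArg (fun x : W.geomTorsion (c : ℤ) ↦ (x : W.geomPoints)) hab))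
    haveI : Finite (W.geomTorsion (c : ℤ)) :=
      WeierstrassCurve.finite_torsionPoints_holds W (AlgebraicClosure K) (Int.natCast_ne_zero.mpr hc0.ne')
    exact Finite.of_injective _ hinj'
  -- bound for each `k`
  have hbound : ∀ k : ℕ, Nat.card (Submodule.torsionBy ℤ (continuousCohomology 1
      ((ρ.restrict (Literature.NumberTheory.GaloisRepresentations.subgroupIncl (absInertia (v.adicCompletion K)))).toTopRep)) ((p ^ k : ℕ) : ℤ)) ≤
      Nat.card Ac := by
    intro k
    -- `E[p^∞][p^k]` is finite and `p^k`-division is possible in `E[p^∞]`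
    haveI : Finite (Submodule.torsionBy ℤ (W.geomPrimaryTorsion p) ((p ^ k : ℕ) : ℤ)) := by
      have hinj' : Injective (fun a : Submodule.torsionBy ℤ (W.geomPrimaryTorsion p) ((p ^ k : ℕ) : ℤ) ↦
          (⟨((a : W.geomPrimaryTorsion p) : W.geomPoints), (W.mem_geomTorsion_iff ((p ^ k : ℕ) : ℤ) _).2 (by
            have := (Submodule.mem_torsionBy_iff _ _).1 a.2
            rw [← AddSubgroupClass.coe_zsmul, this, ZeroMemClass.coe_zero])⟩ :
            W.geomTorsion ((p ^ k : ℕ) : ℤ))) := by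
        intro a b hab
        exact Subtype.ext (Subtype.ext (congrArg (fun x : W.geomTorsion ((p ^ k : ℕ) : ℤ) ↦
          (x : W.geomPoints)) hab))
      haveI : Finite (W.geomTorsion ((p ^ k : ℕ) : ℤ)) :=
        WeierstrassCurve.finite_torsionPoints_holds W (AlgebraicClosure K)
          (Int.natCast_ne_zero.mpr (pow_ne_zero k hp.out.ne_zero))
      exact Finite.of_injective _ hinj'
    have hdiv : ∀ a : W.geomPrimaryTorsion p, ∃ b : W.geomPrimaryTorsion p, p ^ k • b = a := by
      intro a
      obtain ⟨m, hm⟩ := (AddCommGroup.mem_primaryComponent).1 a.2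
      obtain ⟨B, hB⟩ := W.exists_nsmul_eq_geomPoints (W.zsmul_geomPoints_surjective_holds)
        (pow_ne_zero k hp.out.ne_zero) (a : W.geomPoints)
      have hBmem : B ∈ W.geomPrimaryTorsion p := by
        refine (AddCommGroup.mem_primaryComponent).2 ⟨k + m, ?_⟩
        rw [pow_add, mul_comm, mul_nsmul', hB]
        exact hm
      exact ⟨⟨B, hBmem⟩, Subtype.ext (by rw [AddSubmonoidClass.coe_nsmul]; exact hB)⟩
    have hpkv : ((p ^ k : ℕ) : 𝓞 K) ∉ v.asIdeal := by
      intro hmem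
      rw [Nat.cast_pow] at hmem
      exact hpv (v.isPrime.mem_of_pow_mem k hmem)
    have hcop : (p ^ k).Coprime (ringChar 𝓀[v.adicCompletion K]) := by
      have hℓ : (ringChar 𝓀[v.adicCompletion K]).Prime := ringChar_residueField_prime (F := v.adicCompletion K)
      refine Nat.Coprime.pow_left k ((Nat.coprime_primes hp.out hℓ).2 fun h ↦ ?_)
      exact not_ringChar_residueField_adicCompletion_dvd (w := v) hpv (by rw [← h])
    refine (natCard_torsionBy_continuousCohomology_one_absInertia_le (v.adicCompletion K) ρ hcop hdiv).trans ?_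
    -- inertia-fixed `p^k`-torsion is killed by `c`
    refine Nat.card_le_card_of_injective (fun a ↦ (⟨(a.1 : W.geomPrimaryTorsion p), ?_⟩ : Ac)) ?_
    · rw [Submodule.mem_torsionBy_iff, Nat.cast_smul_eq_nsmul]
      -- transport to `E(K̄_v)` and apply the Kodaira–Néron exponent
      have hinjP : Injective (pointsMap W (v.adicCompletion K)) := pointsMapOfEmb_injective W _
      set R : localPoints W (v.adicCompletion K) :=
        pointsMap W (v.adicCompletion K) ((a.1 : W.geomPrimaryTorsion p) : W.geomPoints) with hR
      have hRfix : ∀ τ ∈ absInertia (v.adicCompletion K), τ • R = R := fun τ hτ ↦ by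
        rw [hR, ← pointsMap_smul]
        exact congrArg _ (congrArg Subtype.val (a.2 τ hτ))
      have hRp : p ^ k • R = 0 := by
        rw [hR, ← map_nsmul, ← AddSubgroupClass.coe_nsmul]
        have := (Submodule.mem_torsionBy_iff _ _).1 a.1.2
        rw [Nat.cast_smul_eq_nsmul] at this
        rw [this, ZeroMemClass.coe_zero, map_zero]
      have hcR := nsmul_localPoints_eq_zero_of_absInertia_fixed_of_exponent W v hpv hadd hw h𝔐 hcE₀ R
        hRfix hRp
      apply Subtype.ext
      apply hinjP
      rw [AddSubgroupClass.coe_nsmul, map_nsmul, ← hR, hcR, ZeroMemClass.coe_zero, map_zero]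
    · intro a b hab
      exact Subtype.ext (Subtype.ext (congrArg (fun x : Ac ↦ (x : W.geomPrimaryTorsion p)) hab))
  -- conclusion: finite subsets are bounded
  refine finite_of_forall_finset_card_le (Nat.card Ac) fun s ↦ ?_
  choose k hk using hprimary
  -- a common exponent for the finite set `s`
  obtain ⟨N, hN⟩ := (s.image k).bddAbove
  have hsub : ∀ x ∈ s, x ∈ Submodule.torsionBy ℤ _ ((p ^ N : ℕ) : ℤ) := fun x hx ↦ by
    have hle : k x ≤ N := hN (Finset.mem_coe.2 (Finset.mem_image_of_mem k hx))
    exact Submodule.torsionBy_le_torsionBy_of_dvd _ _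
      (Int.natCast_dvd_natCast.2 (pow_dvd_pow p hle)) (hk x)
  set TN := Submodule.torsionBy ℤ (continuousCohomology 1
      ((ρ.restrict (Literature.NumberTheory.GaloisRepresentations.subgroupIncl (absInertia (v.adicCompletion K)))).toTopRep)) ((p ^ N : ℕ) : ℤ) with hTN
  haveI : Finite TN := by
    haveI : Finite (Submodule.torsionBy ℤ (W.geomPrimaryTorsion p) ((p ^ N : ℕ) : ℤ)) := by
      have hinj' : Injective (fun a : Submodule.torsionBy ℤ (W.geomPrimaryTorsion p) ((p ^ N : ℕ) : ℤ) ↦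
          (⟨((a : W.geomPrimaryTorsion p) : W.geomPoints), (W.mem_geomTorsion_iff ((p ^ N : ℕ) : ℤ) _).2 (by
            have := (Submodule.mem_torsionBy_iff _ _).1 a.2
            rw [← AddSubgroupClass.coe_zsmul, this, ZeroMemClass.coe_zero])⟩ :
            W.geomTorsion ((p ^ N : ℕ) : ℤ))) := by
        intro a b hab
        exact Subtype.ext (Subtype.ext (congrArg (fun x : W.geomTorsion ((p ^ N : ℕ) : ℤ) ↦
          (x : W.geomPoints)) hab))
      haveI : Finite (W.geomTorsion ((p ^ N : ℕ) : ℤ)) :=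
        WeierstrassCurve.finite_torsionPoints_holds W (AlgebraicClosure K)
          (Int.natCast_ne_zero.mpr (pow_ne_zero N hp.out.ne_zero))
      exact Finite.of_injective _ hinj'
    have hdivN : ∀ a : W.geomPrimaryTorsion p, ∃ b : W.geomPrimaryTorsion p, p ^ N • b = a := by
      intro a
      obtain ⟨m, hm⟩ := (AddCommGroup.mem_primaryComponent).1 a.2
      obtain ⟨B, hB⟩ := W.exists_nsmul_eq_geomPoints (W.zsmul_geomPoints_surjective_holds)
        (pow_ne_zero N hp.out.ne_zero) (a : W.geomPoints)
      have hBmem : B ∈ W.geomPrimaryTorsion p := by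
        refine (AddCommGroup.mem_primaryComponent).2 ⟨N + m, ?_⟩
        rw [pow_add, mul_comm, mul_nsmul', hB]
        exact hm
      exact ⟨⟨B, hBmem⟩, Subtype.ext (by rw [AddSubmonoidClass.coe_nsmul]; exact hB)⟩
    have hpNv : ((p ^ N : ℕ) : 𝓞 K) ∉ v.asIdeal := by
      intro hmem
      rw [Nat.cast_pow] at hmem
      exact hpv (v.isPrime.mem_of_pow_mem N hmem)
    have hcopN : (p ^ N).Coprime (ringChar 𝓀[v.adicCompletion K]) := by
      have hℓ : (ringChar 𝓀[v.adicCompletion K]).Prime := ringChar_residueField_prime (F := v.adicCompletion K)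
      refine Nat.Coprime.pow_left N ((Nat.coprime_primes hp.out hℓ).2 fun h ↦ ?_)
      exact not_ringChar_residueField_adicCompletion_dvd (w := v) hpv (by rw [← h])
    exact finite_torsionBy_continuousCohomology_one_absInertia (v.adicCompletion K) ρ hcopN hdivN
  haveI : Fintype TN := Fintype.ofFinite TN
  calc s.card = (s.subtype (· ∈ TN)).card := by
        rw [Finset.card_subtype, Finset.filter_true_of_mem hsub]
    _ ≤ Fintype.card TN := Finset.card_le_univ _
    _ = Nat.card TN := Nat.card_eq_fintype_card.symm
    _ ≤ Nat.card Ac := hbound N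

end Summit.BirchSwinnertonDyer.Rank1Residual.X2.LocalInertiaCohomologyAdditive

end
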